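import Summits.QuantumFields.YangMills.Theorems.BalabanUVNodesN08HaarCompatibilityGuardHybridLocalDensity
import Summits.QuantumFields.YangMills.Theorems.BalabanUVNodesN08HaarCompatibilityGuardCoreLawSUNExplicitSlot

/-!
# BalabanUVNodes ∕ N08 — (G1) AT THE [B10] SLOT FOR EVERY `N`, UNCONDITIONALLY ON THE STANDING RANGE `|Idx| ≤ 300`: the transported guarded part of a local bump is a LOCAL density
# `B(V↾near) · dV` with an EXPLICIT pointwise bound and small mass — part 40 §3 with its (H_K) hypothesis discharged by n08-w6 g6's explicit constant `K_N = |Idx|^{N²−1} + 1`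

WIDTH SEAT `pub-ymgap-dag-n08-w3` g7, item-3 lineage PART 43 (successor of part 40 `…GuardHybridLocalDensity` §3; consumer of n08-w6 g6 `…GuardCoreLawSUNExplicitSlot.fibre_law_le_explicit`),
2026-08-28.  Track A, DAG node N08 = [Balaban1985UV3] Thm 1 p. 257 (compact) + Thm 2 p. 272; key item K1⁷ `StabilityBAtRecordR13SepCoPH` (stmt-QuantumFields-20542), `--supports … --as helper`.
COUNT-NEUTRAL.

THE POINT (junction n08-w3 × n08-w6, located; count-neutral).  Part 40 §3 delivers the (G1) triple (local ∕ bounded ∕ small) under the fibre-law hypothesis (H_K) at the bonds of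
`S`.  n08-w6 g6 proved (H_K) for print's exp-mean-log averaging on `SU(N)` for EVERY `N` with `K_N = (1∕|Idx|)^{−(N²−1)} + 1` on `|Idx| ≤ 300` (`fibre_law_le_explicit`).  Feeding
it in (§1 `exists_local_density_guard_avOfPrint_explicit`): for every `N`, every in-range level, every finset `S` of coarse bonds, block set `𝔅 ⊇ Blk(S)`, `δ′ > 0` and measurable
`0 ≤ ρ ≤ C` reading only the blocks of `𝔅`, **there is a measurable `B ≤ h(δ′)^{−|S|}·C·(h(δ′) + (K_N−1)·h(δ_N+δ′)^{L^{d−1}−1})^{|S|}` on the near coordinates with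
`((ρ·1_{G_S})·dU)∘(Ū^S)⁻¹ = B(V↾near_𝔅)·dV` and `∫ ρ·1_{G_S} dU ≤ C·h(δ_N)^{|S|(L^{d−1}−1)}`** — NO hypothesis beyond the standing range.

HONEST FRAMING.  [folklore] bookkeeping BY IMPORT (part 40 + n08-w6's explicit (H_K)); nothing of Bałaban's asserted; ONE RG step — NO (G3) ∕ cluster expansion ∕ k-uniform
`hmass`; E6′ NOT decided; N08 NOT discharged; counts unmoved (typed 28∕28 · discharged 5∕27); one finite 𝕋⁴ programme at fixed ε — R4 closes the CONDITIONAL rung `BalabanLadder.UV`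
only; the Yang–Mills mass gap (Clay) is NOT proved by any of this; nothing continuum ∕ ℝ⁴ ∕ OS.  0 `sorry`, 0 `def`, 0 `instance`, standard axioms.
-/

noncomputable section

open MeasureTheory
open scoped ENNReal

namespace Summit.QuantumFields.YangMills.BalabanUVNodes.N08HaarCompatibilityGuardHybridLocalDensityExplicit

open Literature.MathematicalPhysics.QuantumFieldTheory.Balaban1983to89
open Literature.MathematicalPhysics.QuantumFieldTheory.Balaban1983to89.AveragingRT (axialAvg)
open Literature.MathematicalPhysics.QuantumFieldTheory.Balaban1983to89.BlockAveraging (Idx Small avgFun)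
open Literature.MathematicalPhysics.QuantumFieldTheory.Balaban1985CMP102.Setting (Scales)
open Literature.MathematicalPhysics.QuantumFieldTheory.Balaban1983to89.ExpMeanLog (expMeanLogSU)
open Literature.MathematicalPhysics.QuantumFieldTheory.Balaban1983to89.Node00 (SU)
open Summit.QuantumFields.Balaban3D.Proofs
open Summit.QuantumFields.YangMills.BalabanUVNodes.N08HaarCompatibilityGuardHybridLocalDensity (exists_local_density_guard_avOfPrint)
open Summit.QuantumFields.YangMills.BalabanUVNodes.N08HaarCompatibilityGuardCoreLawSUNExplicitSlot (fibre_law_le_explicit)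

variable (N : ℕ) [NeZero N] {L : ℕ}

/-- ★★★ **(G1) AT THE SLOT FOR EVERY `N`, NO (H_K) HYPOTHESIS** (standing range `|Idx| ≤ 300`): the transported guarded part `((ρ·1_{G_S})·dU)∘(Ū^S)⁻¹` of a measurable bump
`0 ≤ ρ ≤ C` reading only the blocks of `𝔅 ⊇ Blk(S)` is `B(V↾{bonds with both end blocks in 𝔅})·dV` with
**`B ≤ h(δ′)^{−|S|}·C·(h(δ′) + (K_N−1)·h(δ_N+δ′)^{L^{d−1}−1})^{|S|}` everywhere, `K_N = (1∕|Idx|)^{−(N²−1)} + 1`, and mass `≤ C·h(δ_N)^{|S|(L^{d−1}−1)}`**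
(part 40 §3 + n08-w6's `fibre_law_le_explicit`). [cite: Balaban1985UV3, (2) p.256; Balaban1985Averaging, (15)+(19) p.19–21; Balaban1987RG1, (0.4) p.253 (bookkeeping — the bound is NOT in print)] -/
theorem exists_local_density_guard_avOfPrint_explicit (S₀ : Scales L) (hI : Fintype.card (Idx S₀.P) ≤ 300) {j : ℕ} (hj : j + 1 ≤ S₀.P.m + S₀.P.K)
    [DecidableEq (PBond S₀.P (j + 1))] (S : Finset (PBond S₀.P (j + 1))) (𝔅 : Finset (Site S₀.P (j + 1))) (hS : ∀ c ∈ S, c.src ∈ 𝔅 ∧ c.tgt ∈ 𝔅)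
    {δ' : ℝ} (hδ' : 0 < δ')
    (ρ : Density S₀.P j (SU N)) (hρm : Measurable ρ) {C : ℝ} (hρ0 : ∀ W, 0 ≤ ρ W) (hρC : ∀ W, ρ W ≤ C)
    (hloc : ∀ W W' : GaugeField S₀.P j (SU N), (∀ b : PBond S₀.P j, blockOf b.src ∈ 𝔅 → W b = W' b) → ρ W = ρ W') :
    ∃ B : ({c : PBond S₀.P (j + 1) // ¬ (c.src ∉ 𝔅 ∨ c.tgt ∉ 𝔅)} → SU N) → ℝ≥0∞, Measurable B ∧
      (∀ x, B x ≤ ((HaarData.haar : Measure (SU N)) {g : SU N | dist1 g < δ'} ^ S.card)⁻¹ *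
        (ENNReal.ofReal C * ((HaarData.haar : Measure (SU N)) {g : SU N | dist1 g < δ'} +
          ((ENNReal.ofReal (((Fintype.card (Idx S₀.P) : ℝ))⁻¹ ^ (N ^ 2 - 1)))⁻¹ + 1 - 1) *
            (HaarData.haar : Measure (SU N)) {g : SU N | dist1 g < min (1 / 3) (Real.pi / N) + δ'} ^ (S₀.P.L ^ (S₀.P.d - 1) - 1)) ^ S.card)) ∧
      ((fieldMeasure S₀.P j (SU N)).withDensity fun U => ENNReal.ofReal
          (ρ U * {W : GaugeField S₀.P j (SU N) | ∀ c ∈ S, Small (expMeanLogSU : LoopAverage (SU N)) W c}.indicator (fun _ => (1 : ℝ)) U)).map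
          (fun U => (fun c => if c ∈ S then avgFun (expMeanLogSU : LoopAverage (SU N)) U c else axialAvg U c : GaugeField S₀.P (j + 1) (SU N))) =
        (fieldMeasure S₀.P (j + 1) (SU N)).withDensity (fun V =>
          B (FibreSplit.splitEquiv (fun c : PBond S₀.P (j + 1) => c.src ∉ 𝔅 ∨ c.tgt ∉ 𝔅) (P := S₀.P) (G := SU N) V).1) ∧
      ENNReal.ofReal (∫ U, ρ U * {W : GaugeField S₀.P j (SU N) | ∀ c ∈ S, Small (expMeanLogSU : LoopAverage (SU N)) W c}.indicator (fun _ => (1 : ℝ)) U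
          ∂(fieldMeasure S₀.P j (SU N))) ≤
        ENNReal.ofReal C * (HaarData.haar : Measure (SU N)) {g : SU N | dist1 g < min (1 / 3) (Real.pi / N)} ^ (S.card * (S₀.P.L ^ (S₀.P.d - 1) - 1)) := by
  have hcard : (0 : ℝ) < Fintype.card (Idx S₀.P) := Nat.cast_pos.mpr Fintype.card_pos
  have hKt : (ENNReal.ofReal (((Fintype.card (Idx S₀.P) : ℝ))⁻¹ ^ (N ^ 2 - 1)))⁻¹ + 1 ≠ ∞ :=
    ENNReal.add_ne_top.2 ⟨ENNReal.inv_ne_top.2 (ENNReal.ofReal_pos.2 (pow_pos (inv_pos.2 hcard) _)).ne', ENNReal.one_ne_top⟩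
  exact exists_local_density_guard_avOfPrint N S₀ hj S 𝔅 hS le_add_self hKt (fun c _ U hU => fibre_law_le_explicit (N := N) hI hj c U hU) hδ' ρ hρm hρ0 hρC hloc

end Summit.QuantumFields.YangMills.BalabanUVNodes.N08HaarCompatibilityGuardHybridLocalDensityExplicit

end
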